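import Mathlib
import HarnessLib
import Summits.NavierStokesRegularity.NavierStokesRegularity.Theorems.QuarterLogPincerEmberCensusDefs
import Summits.NavierStokesRegularity.NavierStokesRegularity.Theorems.QuarterLogPincerLimitSilenceDefs

/-!
# Route `QuarterLogPincer`, crux `TypeIQuantSubcubicExp` (stmt-NavierStokesRegularity-24077), line `silencing_cost` —
# the line's OBJECTS, verbatim (Defs file)

VERBATIM port of the statement objects of §S of ns-idea-7's workfile `Cruxes/TypeIQuantSubcubicExp/Lines/silencing_cost.lean`
(v1.1, 338118c44af2; idea-crit-4 g8 PASS 2026-08-29T06:01Z): `BoxBound` (+ `boxBound_mono`), Sa `RegularAftermath`, Sb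
`VorticalCentre`, Sc `EnstrophyPersistence`, Sv `VorticityInequality`, Sd `EmberReadout`, in the decl-of-record namespace
`…Cruxes.TypeIQuantSubcubicExp.SilencingCost`.  `Hot` / `Terminal` / `TerminalEmber` are IMPORTED from `…EmberCensusDefs` and
Sc′ `ThickBoxSilencingCost` from `…LimitSilenceDefs` (`LimitSilence.ThickBoxSilencingCost`, byte-identical to the workfile's
restatement, idea-crit-4 g8 06:13Z) instead of restated.  Only textual change: the local notation `E3` is unfolded (no
notation declared).  No stub is proved here (Sd and Sv are the tree theorems `SilencingCost.emberReadout` (p705884) and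
`SilencingCost.vorticityInequality` (p706103); the by-name one-liners live in `…SilencingCostKernel`).  HONEST FRAME: Props
about HYPOTHETICAL Type-I classical solutions / `C²` fields; nothing here bears on 24077's truth, W7 or Navier–Stokes regularity
(OPEN / not proved).  pub-ns-dss typer (g38), `--supports stmt-NavierStokesRegularity-24077`; text by ns-idea-7 (g12).
-/

set_option linter.dupNamespace false

namespace Summit.NavierStokesRegularity.NavierStokesRegularity.Cruxes.TypeIQuantSubcubicExp.SilencingCost

noncomputable section

open MeasureTheory Set Function Filter Topology Metric
open scoped ENNReal NNReal Classical Laplacian RealInnerProductSpace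
open Literature.Analysis Literature.Analysis.FluidPDE
open Summit.NavierStokesRegularity.NavierStokesRegularity.Cruxes.TypeIQuantSubcubicExp.EmberCensus (Hot Terminal TerminalEmber)
open Summit.NavierStokesRegularity.NavierStokesRegularity.Cruxes.TypeIQuantSubcubicExp.LimitSilence (ThickBoxSilencingCost)

/-- **`C²` BOX BOUND at scale `σ`**: on the time set `S` and the ball `B(y,ρ)` the velocity and its first two
spatial derivatives obey the scale-`σ` bounds `‖∇ʲu(s)‖ ≤ M₁ σ^{-(j+1)}`, `j ≤ 2`. -/
def BoxBound (M₁ σ : ℝ) (u : ℝ → (EuclideanSpace ℝ (Fin 3)) → (EuclideanSpace ℝ (Fin 3))) (y : (EuclideanSpace ℝ (Fin 3)))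
    (S : Set ℝ) (ρ : ℝ) : Prop :=
  ∀ s ∈ S, ∀ x ∈ ball y ρ, ∀ j : ℕ, j ≤ 2 →
    ‖iteratedFDeriv ℝ j (u s) x‖ ≤ M₁ * σ ^ (-((j : ℝ) + 1))

/-- `BoxBound` is monotone in the radius (the only non-`def` line of §S's objects; a docstring is added here, the body is
verbatim). -/
theorem boxBound_mono {M₁ σ : ℝ} {u : ℝ → (EuclideanSpace ℝ (Fin 3)) → (EuclideanSpace ℝ (Fin 3))} {y : (EuclideanSpace ℝ (Fin 3))}
    {S : Set ℝ} {ρ ρ' : ℝ}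
    (h : BoxBound M₁ σ u y S ρ) (hρ : ρ' ≤ ρ) : BoxBound M₁ σ u y S ρ' :=
  fun s hs x hx j hj => h s hs x (ball_subset_ball hρ hx) j hj

/-- **Sa — `RegularAftermath` (size M–L; PUBLISHED MECHANISMS; `A`-free).**  There is an absolute `ε₀ > 0`
such that for `0 < ε ≤ ε₀`, `M ≥ 1` there is `M₁ = M₁(ε,M) ≥ 1` (INDEPENDENT of the aperture) with: in the
crux frame with virtual rate `M`, for every aperture `K ≥ 1`, an ε-hot event `(y,t)` that is `K`-terminal up
to `t₁` has the `C²` box bound `‖∇ʲu(s,x)‖ ≤ M₁σ^{-(j+1)}` (`σ = √(T'−t)`, `T' = T+τ`) for `s ∈ [t,t₁]`,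
`x ∈ B(y,2Kσ)`.  Mechanism: a point `(x₀,t₀)` of the box with clock `T'−t₀ ≥ σ²/8` is handled by the rate
(`|u| ≤ √8·M/σ` on its backward cylinder of radius `σ/4`, which stays in `[t−σ²/2,t₀] ⊂ [0,T]` by the hot
event's room `σ² ≤ t`) and Serrin/KNSS interior smoothing; a point with clock `< σ²/8` lies in the LATE SLAB
`s ≥ T'−σ²/4 = t + 3σ²/4`, where terminality makes every `(x,s)`, `x ∈ B(y,4Kσ)`, ε-COLD (`‖u(s,x)‖ ≤
ε(T'−s)^{-1/2}` — the room clause of `Hot` holds automatically after `t`), so on its backward cylinder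
`Q_{r₀}(x₀,t₀)`, `r₀² = t₀ − (T'−σ²/4) ≥ σ²/8`, the Gustafson–Kang–Tsai `(p,q) = (∞,1)` quantity
`ρ⁻¹∫ sup_{B_ρ}|u| ds ≤ ρ⁻¹·ε·2ρ = 2ε` at EVERY `ρ ≤ r₀` (the `L¹`-in-time norm integrates the clock); GKT's
local-energy iteration [Gustafson–Kang–Tsai CMP 2007, arXiv:math/0607114, Thm 1.1(i)], SEEDED by the tree's
proved I1 (`ThinCascade.stub_uniformScaledEnergy`: `A,E,D ≤ C(M)` at every vertex/scale of the frame
restricted to `[0,t₀]`), reaches the Caffarelli–Kohn–Nirenberg threshold after `O(log(C(M)/ε₀))` halvings: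
`‖∇ʲu‖ ≤ C_j(M) r₀^{-(j+1)}` on `Q_{r₀/2}(x₀,t₀)`.  Why it might fail: not as mathematics; the quantitative
form of GKT's criterion (explicit dependence of the regularity radius on the seed) is implicit in print —
porting cost.  Sources: arXiv:math/0607114 Thm 1.1; [CaffarelliKohnNirenberg1982]; Serrin 1962 / KNSS interior
estimates; I1 = `Theorems/QuarterLogPincerTypeIQuantSubcubicExpStubUniformScaledEnergy.lean`. -/
def RegularAftermath : Prop :=
  ∃ ε₀ : ℝ, 0 < ε₀ ∧ ∀ ε M : ℝ, 0 < ε → ε ≤ ε₀ → 1 ≤ M → ∃ M₁ : ℝ, 1 ≤ M₁ ∧ ∀ K : ℝ, 1 ≤ K →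
    ∀ (T τ : ℝ) (u : ℝ → (EuclideanSpace ℝ (Fin 3)) → (EuclideanSpace ℝ (Fin 3))) (p : ℝ → (EuclideanSpace ℝ (Fin 3)) → ℝ),
      (IsClassicalNSSolutionOn (Icc 0 T) 1 0 u p ∧
          ∀ m : ℕ, ∃ C : NNReal, ∀ t ∈ Icc 0 T, eLpNorm (iteratedFDeriv ℝ m (u t)) 2 volume ≤ C) →
        0 < τ →
        (∀ t ∈ Icc 0 T, ∀ x : (EuclideanSpace ℝ (Fin 3)), ‖u t x‖ ≤ M * (T + τ - t) ^ (-(1 / 2 : ℝ))) →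
        ∀ (t₁ : ℝ) (y : (EuclideanSpace ℝ (Fin 3))) (t : ℝ), t₁ ∈ Ioc 0 T → t ≤ t₁ →
          Hot ε (T + τ) u y t → Terminal K ε (T + τ) t₁ u y t →
          BoxBound M₁ (Real.sqrt (T + τ - t)) u y (Icc t t₁) (2 * K * Real.sqrt (T + τ - t))

/-- **Sb — `VorticalCentre` (size M; ELEMENTARY, time-independent; the STREAM EXCLUSION).**  For `ε > 0`,
`M₁ ≥ 1` and any energy constant `C₀` there are `Γ₂ = Γ₂(ε,C₀) ≥ 1` and `δ = δ(ε,M₁) > 0`: a `C²`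
divergence-free field `v` on `ℝ³` with the scale-`σ` `C²` bound on `B(y,σ)`, slice energy
`∫_{B(y,Γ₂σ)}|v|² ≤ C₀Γ₂σ` and a HOT CENTRE `σ|v(y)| > ε` has enstrophy `∫_{B(y,Γ₂σ)}|curl v|² ≥ δ/σ`.
Mechanism (σ = 1): local Biot–Savart/Helmholtz on the ball `B = B(y,Γ₂)` (tree:
`Literature/Analysis/FluidPDE/LocalBiotSavartHelmholtz.lean`): `v = BS_B[ω] + H`, `H` harmonic in `B`;
`|BS_B[ω](y)| ≤ CρM₁ + Cρ^{-1/2}‖ω‖_{L²(B)}` (near field `|ω| ≤ 2M₁` on `B(y,ρ)`, `ρ ≤ 1`; far field by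
Cauchy–Schwarz); `|H(y)| ≤ (⨍_{B(y,Γ₂/2)}|H|²)^{1/2} ≤ C√C₀/Γ₂ + CΓ₂^{-1/2}‖ω‖_{L²(B)}` (mean value; energy;
Young for `BS_B`); with `Γ₂ = max(1,4C√C₀/ε)` and `ρ = ε/(4CM₁)` the hot centre forces
`‖ω‖²_{L²(B)} ≥ ε³/(64C³M₁) =: δ`.  A constant stream `v ≡ c`, `|c| > ε`, is excluded by the energy
hypothesis once `Γ₂² > 3C₀/(4πε²)` — this is where I1 (not `A`) excludes streams.  Why it might fail: not as
mathematics (explicit vector calculus); porting cost of the local Helmholtz decomposition with constants.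
Sources: Majda–Bertozzi §2.4 (local Biot–Savart); tree `LocalBiotSavartHelmholtz.lean`. -/
def VorticalCentre : Prop :=
  ∀ ε M₁ C₀ : ℝ, 0 < ε → 1 ≤ M₁ → ∃ Γ₂ δ : ℝ, 1 ≤ Γ₂ ∧ 0 < δ ∧
    ∀ (v : (EuclideanSpace ℝ (Fin 3)) → (EuclideanSpace ℝ (Fin 3))) (y : (EuclideanSpace ℝ (Fin 3))) (σ : ℝ),
      0 < σ → ContDiff ℝ 2 v → VectorCalculus.IsDivFree v →
      (∀ x ∈ ball y σ, ∀ j : ℕ, j ≤ 2 → ‖iteratedFDeriv ℝ j v x‖ ≤ M₁ * σ ^ (-((j : ℝ) + 1))) →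
      (∫⁻ x in ball y (Γ₂ * σ), ENNReal.ofReal (‖v x‖ ^ 2) ≤ ENNReal.ofReal (C₀ * (Γ₂ * σ))) →
      ε < σ * ‖v y‖ →
      ENNReal.ofReal (δ / σ) ≤ ∫⁻ x in ball y (Γ₂ * σ), ‖curl v x‖ₑ ^ 2

/-- **Sc — `EnstrophyPersistence` (size L; THE LINE'S LOAD-BEARING LEMMA — LINEAR in `ω`, bounded
coefficients, no Type-I, no `τ`, no `A`, no pressure).**  For `M₁ ≥ 1`, `δ > 0`, `Γ₂ ≥ 1` there are an
aperture `K = K(M₁,δ,Γ₂) ≥ Γ₂` and a floor `c = c(M₁,δ,Γ₂) > 0`: if a classical solution on `[0,T]` obeys the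
`C²` box bound at scale `σ` on `B(y,2Kσ) × [t,t₁]` with span `t₁ − t ≤ σ²`, then centre enstrophy
`∫_{B(y,Γ₂σ)}|ω(t)|² ≥ δ/σ` persists: `∫_{B(y,Kσ)}|ω(t₁)|² ≥ c/σ`.  In the box `ω = curl u` solves the LINEAR
system `∂ₛω − Δω = curl (u × ω) = ω·∇u − u·∇ω` (divergence form; `div u = div ω = 0`), with `|u| ≤ M₁/σ`,
`|∇u| ≤ M₁/σ²`, `|ω| ≤ 2M₁/σ²`, `|∇ω| ≤ 2M₁/σ³`.
SOFT PROOF ROUTE (existence of `K, c`, every ingredient in print): normalise `σ = 1`, `y = 0`, `t = 0` by the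
Navier–Stokes scaling (the box bound and both enstrophy thresholds are scale-covariant).  If the statement
failed for `(M₁,δ,Γ₂)`, there would be classical solutions `uₙ` with the box bound on `B_{2Kₙ} × [0,sₙ]`,
`Kₙ → ∞`, `sₙ ≤ 1`, `∫_{B_{Γ₂}}|ωₙ(0)|² ≥ δ` and `∫_{B_{Kₙ}}|ωₙ(sₙ)|² → 0`.  COMPACTNESS: `ωₙ` is bounded and
equi-Lipschitz in `x`; `∂ₛωₙ = Δωₙ + curl(uₙ × ωₙ)` with `uₙ × ωₙ` bounded makes `s ↦ ∫ωₙφ` equicontinuous for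
every test `φ`, so (interpolating against the Lipschitz bound) `ωₙ → ω` locally UNIFORMLY on `ℝ³ × [0,s]`
along a subsequence (`sₙ → s`), while `uₙ ⇀* u` in `L^∞` with `|∇u| ≤ M₁`, `div u = 0`, `curl u = ω`; strong ×
weak-* convergence passes to the limit in `curl(uₙ × ωₙ)`, so `ω` is a bounded, spatially Lipschitz
distributional solution of `∂ₛω − Δω = ω·∇u − u·∇ω` on `ℝ³ × (0,s)` — `|∂ₛω − Δω| ≤ M₁(|ω| + |∇ω|)`,
`ω ∈ W^{2,1}_{q,loc}` by parabolic `L^q` theory — with `ω(s) ≡ 0` on `ℝ³` (the boxes exhaust space; NO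
lateral boundary survives, far junk is harmless because it is sup-bounded) and `∫_{B_{Γ₂}}|ω(0)|² ≥ δ`.  If
`s = 0` this is absurd; if `s > 0` it contradicts BACKWARD UNIQUENESS for the heat operator with bounded
lower-order terms on `ℝ³` in the bounded class [Escauriaza–Seregin–Šverák, ARMA 169 (2003) — stated for the
harder half-space case; corpus: Seregin, Lecture Notes (2014) App. A, Thm 2.4 / §A.3, pp. 205–214; Poon,
Comm. PDE 21 (1996) Thm 1.1 for the whole space].  QUANTITATIVE ROUTE (explicit `K, c`, optional): lateral
influence `≤ C(M₁)e^{-cK²}` on `B_K` (maximum principle with Gaussian barrier / Aronson), interior floor from the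
Gaussian-weighted parabolic frequency function centred at a coherence point `x*` (`|ω(t,x*)| ≥ c₀√δΓ₂^{-3/2}`,
`ω ≈ ω(x*)` on `B(x*, c₀√δΓ₂^{-3/2}/(4M₁))` — the `∇²u` bound CAPS THE FREQUENCY, which is what stops the
high-frequency burn-out: the exact Beltrami family `e^{-N²s}U_N` obeys `N²σ² ≤ M₁²Γ₂³/δ` under the hypotheses),
drift displacement `≤ M₁σ`; floor `≈ δ·exp(−C M₁²Γ₂³/δ · e^{CM₁²})`.
Why it might fail: not in substance (the soft route is a two-page argument from published theorems); the
risks are bookkeeping — the time-equicontinuity/limit passage must use the divergence form `curl(u × ω)`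
(the velocity `uₙ` itself has NO time compactness: the harmonic part of the pressure is invisible to box
bounds, Serrin's example), and the backward-uniqueness theorem is applied to a `W^{2,1}_{q,loc}`, bounded,
Lipschitz limit.  Killed by: a smooth divergence-free `u` with the box bounds (`σ = 1`) on `B_{2K} × [0,1]`
whose vorticity has `∫_{B_{Γ₂}}|ω(0)|² ≥ δ` and `∫_{B_K}|ω(1)|² → 0` along `K → ∞` at fixed `(M₁,δ,Γ₂)` — by the
soft route such a family would produce a bounded non-zero caloric function (with bounded lower-order terms)
on `ℝ³ × [0,1]` vanishing identically at time `1`.  Sources: ESS 2003 (doi:10.1007/s00205-003-0263-8);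
Poon 1996; Aronson 1967; [corpus:book:seregin2014-lecture-notes-regularity-theory-navier-stokes-equations
pp. 205–214]. -/
def EnstrophyPersistence : Prop :=
  ∀ M₁ δ Γ₂ : ℝ, 1 ≤ M₁ → 0 < δ → 1 ≤ Γ₂ → ∃ K c : ℝ, Γ₂ ≤ K ∧ 0 < c ∧
    ∀ (T : ℝ) (u : ℝ → (EuclideanSpace ℝ (Fin 3)) → (EuclideanSpace ℝ (Fin 3))) (p : ℝ → (EuclideanSpace ℝ (Fin 3)) → ℝ),
      IsClassicalNSSolutionOn (Icc 0 T) 1 0 u p →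
      ∀ (y : (EuclideanSpace ℝ (Fin 3))) (σ t t₁ : ℝ), 0 < σ → 0 ≤ t → t ≤ t₁ → t₁ ≤ T → t₁ ≤ t + σ ^ 2 →
        BoxBound M₁ σ u y (Icc t t₁) (2 * K * σ) →
        ENNReal.ofReal (δ / σ) ≤ ∫⁻ x in ball y (Γ₂ * σ), ‖curl (u t) x‖ₑ ^ 2 →
        ENNReal.ofReal (c / σ) ≤ ∫⁻ x in ball y (K * σ), ‖curl (u t₁) x‖ₑ ^ 2

/-- **Sv — `VorticityInequality` (size M; CALCULUS — the bridge from Navier–Stokes to the inequality class).**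
For `M₁ ≥ 1` there is `B = B(M₁) ≥ 1` (`B = 4M₁` will do): if a classical solution on `[0,T]` obeys the `C²` box
bound `BoxBound M₁ σ u y (Icc t t₁) ρ` (`0 ≤ t < t₁ ≤ T`), then its vorticity `ω = curl u` is jointly smooth on
`[t,t₁] × ℝ³` and satisfies on `B(y,ρ) × [t,t₁]`: `|ω| ≤ Bσ⁻²` (`|curl v| ≤ 2√3|∇v|`), `|∇ω| ≤ Bσ⁻³`, and the
vorticity equation `∂ₛω − Δω = ω·∇u − u·∇ω` (curl of the momentum equation: `curl ∇p = 0`, `ν = 1`, `f = 0`;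
`curl` commutes with `∂ₛ` and `Δ` for jointly smooth `u`; the one-sided time derivative within `[t,t₁]` agrees
with the one within `[0,T]` because `t < t₁`) gives `|∂ₛω − Δω| ≤ |∇u||ω| + |u||∇ω| ≤ M₁σ⁻²|ω| + M₁σ⁻¹|∇ω|`.
Why it might fail: it cannot in substance; the Lean work is the curl/derivative commutation and the identity
`curl((u·∇)u) = (u·∇)ω − (ω·∇)u` for divergence-free `u` (uses `div u = 0`).  Sources: Majda–Bertozzi §1.
(`Literature.Analysis.FluidPDE.curl_gradient_eq_zero` is the tree's named statement of `curl ∇ = 0`.) -/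
def VorticityInequality : Prop :=
  ∀ M₁ : ℝ, 1 ≤ M₁ → ∃ B : ℝ, 1 ≤ B ∧
    ∀ (T : ℝ) (u : ℝ → (EuclideanSpace ℝ (Fin 3)) → (EuclideanSpace ℝ (Fin 3))) (p : ℝ → (EuclideanSpace ℝ (Fin 3)) → ℝ),
      IsClassicalNSSolutionOn (Icc 0 T) 1 0 u p →
    ∀ (y : (EuclideanSpace ℝ (Fin 3))) (σ ρ t t₁ : ℝ), 0 < σ → 0 ≤ t → t < t₁ → t₁ ≤ T →
      BoxBound M₁ σ u y (Icc t t₁) ρ →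
      IsSmoothSpaceTimeOn (Icc t t₁) (fun s => curl (u s)) ∧
      ∀ s ∈ Icc t t₁, ∀ x ∈ ball y ρ,
        ‖curl (u s) x‖ ≤ B * σ ^ (-(2 : ℝ)) ∧ ‖fderiv ℝ (curl (u s)) x‖ ≤ B * σ ^ (-(3 : ℝ)) ∧
        ‖timeDerivWithin (Icc t t₁) (fun s' => curl (u s')) s x - (Δ (curl (u s))) x‖ ≤
          B * σ ^ (-(2 : ℝ)) * ‖curl (u s) x‖ + B * σ ^ (-(1 : ℝ)) * ‖fderiv ℝ (curl (u s)) x‖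

/-- **Sd — `EmberReadout` (size S–M; ELEMENTARY).**  For `K ≥ 1`, `M₁ ≥ 1`, `c > 0` there is
`c' = c'(K,M₁,c) > 0`: a `C²` field with the scale-`σ` `C²` bound on `B(y,2Kσ)` and enstrophy
`∫_{B(y,Kσ)}|curl v|² ≥ c/σ` has cube `∫_{B(y,2Kσ)}|v|³ ≥ c'`.  Mechanism (σ = 1, Taylor): a point
`x* ∈ B_K` with `|curl v(x*)| ≥ (c/|B_K|)^{1/2}`, so `‖Dv(x*)‖ ≥ g := ½(c/|B_K|)^{1/2}` along a unit vector
`e`; with `‖D²v‖ ≤ M₁`, `|v(x*+he) − v(x*)| ≥ ¾hg` for `h = g/(2M₁)`, so `|v| ≥ w := 3g²/(16M₁)` at `x*` or at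
`x*+he`, hence `|v| ≥ w/2` on a ball of radius `w/(2M₁)` inside `B_{2K}`: cube `≥ (w/2)³·(4π/3)(w/(2M₁))³`.
Why it might fail: it cannot (explicit calculus); listed as a stub only because it is a separate `M`-sized
formal lemma (`iteratedFDeriv` ↔ `fderiv`, mean value, measure of a ball).  Sources: elementary. -/
def EmberReadout : Prop :=
  ∀ K M₁ c : ℝ, 1 ≤ K → 1 ≤ M₁ → 0 < c → ∃ c' : ℝ, 0 < c' ∧
    ∀ (v : (EuclideanSpace ℝ (Fin 3)) → (EuclideanSpace ℝ (Fin 3))) (y : (EuclideanSpace ℝ (Fin 3))) (σ : ℝ), 0 < σ → ContDiff ℝ 2 v →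
      (∀ x ∈ ball y (2 * K * σ), ∀ j : ℕ, j ≤ 2 →
        ‖iteratedFDeriv ℝ j v x‖ ≤ M₁ * σ ^ (-((j : ℝ) + 1))) →
      ENNReal.ofReal (c / σ) ≤ ∫⁻ x in ball y (K * σ), ‖curl v x‖ₑ ^ 2 →
      ENNReal.ofReal c' ≤ ∫⁻ x in ball y (2 * K * σ), ‖v x‖ₑ ^ (3 : ℝ)

end

end Summit.NavierStokesRegularity.NavierStokesRegularity.Cruxes.TypeIQuantSubcubicExp.SilencingCost
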